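import Summits.QuantumFields.YangMills.Theorems.FlatTubeReductionExactDressingOfProfileNumbers
import HarnessLib

/-!
# THE EXACT DRESSING IS UNCONDITIONAL FOR CORE-SUPPORTED PROFILES: for ANY colour-blind profile family supported in the fibre core `{cap, ‖v̂‖ ≤ β^{-1/2}, |v_{e,c}| ≤ β^{-1/2}}`
# with positive mass, the dressing `W̃ β = clampW κ (f_β/f_β(1)) (min(d_tor,½))` has ALL five `W`-fields of `RateTube.AnalyticRatePotInput` (every `β`) and is within `O(λ_b(L³β)²)` of
# the normalised exact diagonal ratio on the slow window — the seven scalar numbers of `exactDressing_of_profileNumbers` are trivial (`A = 16`, tails `≡ 0`)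
# (route `FlatTubeReduction`, crux K1 `NearFlatRatioLaw` stmt-QuantumFields-24720; seat `ym-line-ftr-p1` g14; rate twin «ratepack-v3 / frozen fibres»; R2b1 RECORD rung — no summit
# statement is proved here)

WHY (memo `Cruxes/NearFlatRatioLaw/Lines/ratepack-v3-frozen-g12.md` §7).  If `supp Ω β ⊆ C_β`, then `θ_β = ∫_{C_β}Ω β = ∫Ω β = I₀`, `(√β‖v̂‖)^{3n} ≤ 1` and `(1+β‖v̂‖²)⁴ ≤ 16` on the
support, the fibre tails `{β^{1/8} < β‖v̂‖²}` miss the support for `β ≥ 1`, and the coordinate radius `R_τ = β^{-1/2}` is compatible with the window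
(`β·E(β^{-1/2}, 12L³δ₁⁴) = N_P(1728√(12L³)δ₁² + 29376β^{-1/2} + 700569β^{-1}) → 0`).  The physical fibre ground state has width `β^{-1/2}`, so core-supported frozen profiles are the
natural first instance (the truncation is the (B-T)/(B-ST)/(B-OD) pens' business, not the dressing's).
  ★★★★ `exactDressing_of_coreProfile`.
HONEST FRAMING: corollary; the other analytic fields of `AnalyticRatePotInput` (hT near/far at rate, hODpot, hST, hN) remain open; femto rung R2b1 (RECORD label); not infinite volume,
not a gap, not Clay.  No defs, no named facts, no `sorry`.
-/

set_option autoImplicit false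

noncomputable section

open MeasureTheory Filter Topology Real Set
open scoped BigOperators
open Literature.MathematicalPhysics.QuantumFieldTheory
open Literature.MathematicalPhysics.QuantumLattice

namespace Summit.QuantumFields.YangMills.Theorems.FemtoTransferGap.RateTube

open Summit.QuantumFields.YangMills.Theorems.FemtoTransferGap
open Summit.QuantumFields.YangMills.Theorems.FemtoTransferGap.TwoLattice
open Summit.QuantumFields.YangMills.Theorems.FemtoTransferGap.TwoLattice.ConstTube
open Summit.QuantumFields.YangMills.Theorems.FemtoTransferGap.TwoLattice.Avg
open Summit.QuantumFields.YangMills.Theorems.FemtoTransferGap.TwoLattice.Cov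
open Summit.QuantumFields.YangMills.Theorems.FemtoTransferGap.TwoLattice.Stiff (LinkSpace)
open Summit.QuantumFields.YangMills.Theorems.FemtoCutoffLadder

variable {L : ℕ} [NeZero L]

/-- The fibre core `{cap, ‖v̂‖ ≤ s, |v_{e,c}| ≤ s}` is measurable. [folklore] -/
theorem measurableSet_fibreCore (s : ℝ) :
    MeasurableSet {v : Edge 3 L → Fin 3 → ℝ | v ∈ capBalancedSet L ∧ ‖linkEmbed L v‖ ≤ s ∧ ∀ (e : Edge 3 L) (c : Fin 3), |v e c| ≤ s} := by
  have h1 : MeasurableSet {v : Edge 3 L → Fin 3 → ℝ | v ∈ capBalancedSet L} := measurableSet_capBalancedSet L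
  have h2 : MeasurableSet {v : Edge 3 L → Fin 3 → ℝ | ‖linkEmbed L v‖ ≤ s} := measurableSet_le (measurable_linkEmbed L).norm measurable_const
  have h3 : MeasurableSet {v : Edge 3 L → Fin 3 → ℝ | ∀ (e : Edge 3 L) (c : Fin 3), |v e c| ≤ s} := by
    have e : {v : Edge 3 L → Fin 3 → ℝ | ∀ (e : Edge 3 L) (c : Fin 3), |v e c| ≤ s} = ⋂ e : Edge 3 L, ⋂ c : Fin 3, {v | |v e c| ≤ s} := by
      ext v; simp only [Set.mem_setOf_eq, Set.mem_iInter]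
    rw [e]
    exact MeasurableSet.iInter fun e => MeasurableSet.iInter fun c =>
      measurableSet_le (continuous_abs.measurable.comp ((measurable_pi_apply c).comp (measurable_pi_apply e))) measurable_const
  have e : {v : Edge 3 L → Fin 3 → ℝ | v ∈ capBalancedSet L ∧ ‖linkEmbed L v‖ ≤ s ∧ ∀ (e : Edge 3 L) (c : Fin 3), |v e c| ≤ s} =
      {v | v ∈ capBalancedSet L} ∩ ({v | ‖linkEmbed L v‖ ≤ s} ∩ {v | ∀ (e : Edge 3 L) (c : Fin 3), |v e c| ≤ s}) := by
    ext v; simp only [Set.mem_setOf_eq, Set.mem_inter_iff]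
  rw [e]; exact h1.inter (h2.inter h3)

/-- `β·E(β^{-1/2}, 12L³δ₁(β)⁴) ≤ 1` eventually, `δ₁ = D_w·recordDelta1 L (1/6)`. [folklore] -/
theorem window_compatible_invSqrt {Dw : ℝ} (hDw : 0 ≤ Dw) :
    ∀ᶠ β : ℝ in atTop, β * stepActionErr (L := L) (Real.sqrt β)⁻¹ ((L : ℝ) ^ 3 * (12 * (Dw * recordDelta1 L (1 / 6) β) ^ 4)) ≤ 1 := by
  have hN := card_site_pos (L := L)
  have hL0 : (0 : ℝ) ≤ L := Nat.cast_nonneg _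
  have hb : Tendsto (fun β : ℝ => Dw * recordDelta1 L (1 / 6) β) atTop (𝓝 0) := by
    have h := ((tendsto_powScale (σ := 1 / 6) (by norm_num)).const_mul 14).div_const (Fintype.card (Site 3 L) : ℝ) |>.const_mul Dw
    simp only [mul_zero, zero_div] at h
    refine h.congr' (Filter.Eventually.of_forall fun β => ?_)
    unfold recordDelta1; ring
  have hs : Tendsto (fun β : ℝ => (Real.sqrt β)⁻¹) atTop (𝓝 0) := by
    refine (tendsto_rpow_neg_atTop (show (0 : ℝ) < 1 / 2 by norm_num)).congr' ?_
    filter_upwards [Filter.eventually_gt_atTop (0 : ℝ)] with β hβ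
    rw [Real.sqrt_eq_rpow, ← Real.rpow_neg hβ.le]
  have htot : Tendsto (fun β : ℝ => (Fintype.card (Plaquette 3 L) : ℝ) * (1728 * Real.sqrt (12 * (L : ℝ) ^ 3) * (Dw * recordDelta1 L (1 / 6) β) ^ 2 +
      29376 * (Real.sqrt β)⁻¹ + 700569 * (Real.sqrt β)⁻¹ ^ 2)) atTop (𝓝 0) := by
    have h := (((hb.pow 2).const_mul (1728 * Real.sqrt (12 * (L : ℝ) ^ 3))).add ((hs.const_mul 29376).add ((hs.pow 2).const_mul 700569))).const_mul
      (Fintype.card (Plaquette 3 L) : ℝ)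
    simp only [zero_pow (by norm_num : (2 : ℕ) ≠ 0), mul_zero, add_zero] at h
    refine h.congr' (Filter.Eventually.of_forall fun β => ?_)
    ring
  filter_upwards [htot.eventually (eventually_le_nhds (show (0 : ℝ) < 1 by norm_num)), Filter.eventually_ge_atTop (900 : ℝ)] with β hβ hβ9
  obtain ⟨hs0, -, hs1, hβs, hβ0⟩ := inv_sqrt_window hβ9
  have hb0 : 0 ≤ Dw * recordDelta1 L (1 / 6) β := by
    unfold recordDelta1; exact mul_nonneg hDw (div_nonneg (by linarith [powScale_pos (1 / 6) β]) hN.le)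
  unfold stepActionErr
  rw [diag_sqrt_sigma (by positivity : (0 : ℝ) ≤ (L : ℝ)) (Dw * recordDelta1 L (1 / 6) β)]
  have e : β * ((Fintype.card (Plaquette 3 L) : ℝ) * (1728 * (Real.sqrt β)⁻¹ ^ 2 * (Real.sqrt (12 * (L : ℝ) ^ 3) * (Dw * recordDelta1 L (1 / 6) β) ^ 2) +
      29376 * (Real.sqrt β)⁻¹ ^ 3 + 700569 * (Real.sqrt β)⁻¹ ^ 4)) =
      (Fintype.card (Plaquette 3 L) : ℝ) * (1728 * Real.sqrt (12 * (L : ℝ) ^ 3) * (Dw * recordDelta1 L (1 / 6) β) ^ 2 * (β * (Real.sqrt β)⁻¹ ^ 2) +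
        29376 * (Real.sqrt β)⁻¹ * (β * (Real.sqrt β)⁻¹ ^ 2) + 700569 * (Real.sqrt β)⁻¹ ^ 2 * (β * (Real.sqrt β)⁻¹ ^ 2)) := by ring
  rw [e, hβs, mul_one, mul_one, mul_one]
  exact hβ

set_option maxHeartbeats 1600000 in
/-- ★★★★ **THE EXACT DRESSING FOR CORE-SUPPORTED PROFILES, UNCONDITIONALLY.**  Window `δ₁ = D_w·recordDelta1 L (1/6)` (`D_w ≥ 0`); a profile family `Ω β` (measurable,
`0 ≤ Ω β ≤ CΩ β`, colour-blind) supported in the fibre core `{cap, ‖v̂‖ ≤ (√β)⁻¹, |v_{e,c}| ≤ (√β)⁻¹}` for every `β`, with `∫Ω β dπ > 0` eventually.  THEN with the FP window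
`ε = (√β)⁻¹` the conclusion of `exactDressing_fields` holds: `∃ κ ≥ 0, ε_W = O(λ_b²)` such that `W̃ β = clampW κ (f_β/f_β(1)) (min(d_tor,½))` is physical, `0 ≤ W̃ ≤ √(1+κ/4)`,
`|W̃ β u² − 1| ≤ κ·orbitDist u²` on the window for every `β`, and `|W̃ β u² − f̂_β u| ≤ ε_W β` on the window eventually. [cite: Luscher1983, §3] -/
theorem exactDressing_of_coreProfile {Dw : ℝ} (hDw : 0 ≤ Dw) (Ω : ℝ → LinkSpace L → ℝ) (CΩ : ℝ → ℝ)
    (hΩm : ∀ β, Measurable (Ω β)) (hCΩ : ∀ β x, |Ω β x| ≤ CΩ β) (hΩ0 : ∀ β x, 0 ≤ Ω β x) (hΩinv : ∀ β (g : SU2) (x : LinkSpace L), Ω β (adL L g x) = Ω β x)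
    (hΩs : ∀ β (v : Edge 3 L → Fin 3 → ℝ), Ω β (linkEmbed L v) ≠ 0 →
      v ∈ capBalancedSet L ∧ ‖linkEmbed L v‖ ≤ (Real.sqrt β)⁻¹ ∧ ∀ (e : Edge 3 L) (c : Fin 3), |v e c| ≤ (Real.sqrt β)⁻¹)
    (hθ : ∀ᶠ β : ℝ in atTop, 0 < ∫ v, Ω β (linkEmbed L v) ∂orthoTransverse L) :
    ∃ κ : ℝ, 0 ≤ κ ∧ ∃ εW : ℝ → ℝ, (∃ a' : ℝ, ∀ᶠ β : ℝ in atTop, εW β ≤ a' * bareLambda ((L : ℝ) ^ 3 * β) ^ 2) ∧ (∀ᶠ β : ℝ in atTop, 0 ≤ εW β) ∧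
      (∀ β, IsPhys (clampW κ (fun u : GaugeConfig 3 1 SU2 => fpBOKernel L β (Ω β) (fpWeight L (Real.sqrt β)⁻¹) u u / transferKernel su2Rep ((L : ℝ) ^ 3 * β) u u /
          (fpBOKernel L β (Ω β) (fpWeight L (Real.sqrt β)⁻¹) 1 1 / transferKernel su2Rep ((L : ℝ) ^ 3 * β) (1 : GaugeConfig 3 1 SU2) 1))
        (fun U : GaugeConfig 3 1 SU2 => min (torDist U) (1 / 2)))) ∧
      (∀ β u, 0 ≤ clampW κ (fun u : GaugeConfig 3 1 SU2 => fpBOKernel L β (Ω β) (fpWeight L (Real.sqrt β)⁻¹) u u / transferKernel su2Rep ((L : ℝ) ^ 3 * β) u u /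
          (fpBOKernel L β (Ω β) (fpWeight L (Real.sqrt β)⁻¹) 1 1 / transferKernel su2Rep ((L : ℝ) ^ 3 * β) (1 : GaugeConfig 3 1 SU2) 1))
        (fun U : GaugeConfig 3 1 SU2 => min (torDist U) (1 / 2)) u) ∧
      (∀ β u, |clampW κ (fun u : GaugeConfig 3 1 SU2 => fpBOKernel L β (Ω β) (fpWeight L (Real.sqrt β)⁻¹) u u / transferKernel su2Rep ((L : ℝ) ^ 3 * β) u u /
          (fpBOKernel L β (Ω β) (fpWeight L (Real.sqrt β)⁻¹) 1 1 / transferKernel su2Rep ((L : ℝ) ^ 3 * β) (1 : GaugeConfig 3 1 SU2) 1))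
        (fun U : GaugeConfig 3 1 SU2 => min (torDist U) (1 / 2)) u| ≤ Real.sqrt (1 + κ / 4)) ∧
      (∀ β u, orbitDist u < Dw * recordDelta1 L (1 / 6) β →
        |clampW κ (fun u : GaugeConfig 3 1 SU2 => fpBOKernel L β (Ω β) (fpWeight L (Real.sqrt β)⁻¹) u u / transferKernel su2Rep ((L : ℝ) ^ 3 * β) u u /
          (fpBOKernel L β (Ω β) (fpWeight L (Real.sqrt β)⁻¹) 1 1 / transferKernel su2Rep ((L : ℝ) ^ 3 * β) (1 : GaugeConfig 3 1 SU2) 1))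
        (fun U : GaugeConfig 3 1 SU2 => min (torDist U) (1 / 2)) u ^ 2 - 1| ≤ κ * orbitDist u ^ 2) ∧
      (∀ᶠ β : ℝ in atTop, ∀ u : GaugeConfig 3 1 SU2, orbitDist u < Dw * recordDelta1 L (1 / 6) β →
        |clampW κ (fun u : GaugeConfig 3 1 SU2 => fpBOKernel L β (Ω β) (fpWeight L (Real.sqrt β)⁻¹) u u / transferKernel su2Rep ((L : ℝ) ^ 3 * β) u u /
          (fpBOKernel L β (Ω β) (fpWeight L (Real.sqrt β)⁻¹) 1 1 / transferKernel su2Rep ((L : ℝ) ^ 3 * β) (1 : GaugeConfig 3 1 SU2) 1))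
        (fun U : GaugeConfig 3 1 SU2 => min (torDist U) (1 / 2)) u ^ 2 -
          fpBOKernel L β (Ω β) (fpWeight L (Real.sqrt β)⁻¹) u u / transferKernel su2Rep ((L : ℝ) ^ 3 * β) u u /
            (fpBOKernel L β (Ω β) (fpWeight L (Real.sqrt β)⁻¹) 1 1 / transferKernel su2Rep ((L : ℝ) ^ 3 * β) (1 : GaugeConfig 3 1 SU2) 1)| ≤ εW β) := by
  haveI := isFiniteMeasure_orthoTransverse L
  have hle := measurable_linkEmbed L
  -- the fibre cores and the mass
  set C : ℝ → Set (Edge 3 L → Fin 3 → ℝ) := fun β => {v | v ∈ capBalancedSet L ∧ ‖linkEmbed L v‖ ≤ (Real.sqrt β)⁻¹ ∧ ∀ (e : Edge 3 L) (c : Fin 3), |v e c| ≤ (Real.sqrt β)⁻¹} with hCdef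
  have hC : ∀ β, MeasurableSet (C β) := fun β => measurableSet_fibreCore (L := L) (Real.sqrt β)⁻¹
  have hCsub : ∀ β, ∀ v ∈ C β, v ∈ capBalancedSet L ∧ ‖linkEmbed L v‖ ≤ (Real.sqrt β)⁻¹ ∧ ∀ (e : Edge 3 L) (c : Fin 3), |v e c| ≤ (Real.sqrt β)⁻¹ := fun β v hv => hv
  have hθC : ∀ β, ∫ v in C β, Ω β (linkEmbed L v) ∂orthoTransverse L = ∫ v, Ω β (linkEmbed L v) ∂orthoTransverse L := fun β =>
    setIntegral_eq_integral_of_forall_compl_eq_zero fun v hv => by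
      by_contra h; exact hv (hΩs β v h)
  -- integrability of the profile numbers' integrands
  have hint : ∀ β (g : (Edge 3 L → Fin 3 → ℝ) → ℝ), Measurable g → (∀ v, 0 ≤ g v) → (∀ v, Ω β (linkEmbed L v) ≠ 0 → g v ≤ 16) →
      ∫ v, Ω β (linkEmbed L v) * g v ∂orthoTransverse L ≤ 16 * ∫ v in C β, Ω β (linkEmbed L v) ∂orthoTransverse L := by
    intro β g hgm hg0 hg
    rw [hθC β, ← integral_const_mul]
    have hpt : ∀ v, Ω β (linkEmbed L v) * g v ≤ 16 * Ω β (linkEmbed L v) := fun v => by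
      by_cases h : Ω β (linkEmbed L v) = 0
      · rw [h]; simp
      · nlinarith [hg v h, hΩ0 β (linkEmbed L v), hg0 v]
    have hCΩ0 : 0 ≤ CΩ β := (abs_nonneg _).trans (hCΩ β 0)
    refine integral_mono_of_nonneg (ae_of_all _ fun v => mul_nonneg (hΩ0 β _) (hg0 v)) ?_ (ae_of_all _ hpt)
    exact (integrable_of_measurable_abs_le (orthoTransverse L) (hΩm β |>.comp hle) (fun v => hCΩ β _)).const_mul 16
  -- pointwise facts on the support
  have hsupp : ∀ β v, Ω β (linkEmbed L v) ≠ 0 → 0 < β → Real.sqrt β * ‖linkEmbed L v‖ ≤ 1 ∧ β * ‖linkEmbed L v‖ ^ 2 ≤ 1 := by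
    intro β v hv hβ0
    obtain ⟨-, hr, -⟩ := hΩs β v hv
    have hs0 : 0 < Real.sqrt β := Real.sqrt_pos.mpr hβ0
    have h1 : Real.sqrt β * ‖linkEmbed L v‖ ≤ 1 := by
      calc Real.sqrt β * ‖linkEmbed L v‖ ≤ Real.sqrt β * (Real.sqrt β)⁻¹ := mul_le_mul_of_nonneg_left hr hs0.le
        _ = 1 := mul_inv_cancel₀ hs0.ne'
    refine ⟨h1, ?_⟩
    have h2 : β * ‖linkEmbed L v‖ ^ 2 = (Real.sqrt β * ‖linkEmbed L v‖) ^ 2 := by rw [mul_pow, Real.sq_sqrt hβ0.le]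
    rw [h2]; nlinarith [mul_nonneg hs0.le (norm_nonneg (linkEmbed L v))]
  -- the seven scalar facts
  have hθ' : ∀ᶠ β : ℝ in atTop, 0 < ∫ v in C β, Ω β (linkEmbed L v) ∂orthoTransverse L := by filter_upwards [hθ] with β h; rwa [hθC β]
  have hθ0 : ∀ β, 0 ≤ ∫ v in C β, Ω β (linkEmbed L v) ∂orthoTransverse L := fun β => by rw [hθC β]; exact integral_nonneg fun v => hΩ0 β _
  have hI : ∀ᶠ β : ℝ in atTop, ∫ v, Ω β (linkEmbed L v) ∂orthoTransverse L ≤ 16 * ∫ v in C β, Ω β (linkEmbed L v) ∂orthoTransverse L :=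
    Filter.Eventually.of_forall fun β => by rw [← hθC β]; linarith [hθ0 β]
  have hM : ∀ᶠ β : ℝ in atTop, ∫ v, Ω β (linkEmbed L v) * (Real.sqrt β * ‖linkEmbed L v‖) ^ (3 * Fintype.card {x : Site 3 L // ¬x = 0}) ∂orthoTransverse L ≤
      16 * ∫ v in C β, Ω β (linkEmbed L v) ∂orthoTransverse L := by
    filter_upwards [Filter.eventually_gt_atTop (0 : ℝ)] with β hβ0
    refine hint β _ ((measurable_const.mul hle.norm).pow_const _) (fun v => by positivity) fun v hv => ?_
    exact (pow_le_one₀ (by positivity) (hsupp β v hv hβ0).1).trans (by norm_num)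
  have hI4 : ∀ᶠ β : ℝ in atTop, ∫ v, Ω β (linkEmbed L v) * (1 + β * ‖linkEmbed L v‖ ^ 2) ^ 4 ∂orthoTransverse L ≤ 16 * ∫ v in C β, Ω β (linkEmbed L v) ∂orthoTransverse L := by
    filter_upwards [Filter.eventually_gt_atTop (0 : ℝ)] with β hβ0
    refine hint β _ ((measurable_const.add ((hle.norm.pow_const 2).const_mul β)).pow_const 4) (fun v => by positivity) fun v hv => ?_
    have := (hsupp β v hv hβ0).2
    calc (1 + β * ‖linkEmbed L v‖ ^ 2) ^ 4 ≤ (1 + 1) ^ 4 := pow_le_pow_left₀ (by positivity) (by linarith) 4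
      _ = 16 := by norm_num
  have hM4 : ∀ᶠ β : ℝ in atTop, ∫ v, Ω β (linkEmbed L v) * (1 + β * ‖linkEmbed L v‖ ^ 2) ^ 4 * (Real.sqrt β * ‖linkEmbed L v‖) ^ (3 * Fintype.card {x : Site 3 L // ¬x = 0}) ∂orthoTransverse L ≤
      16 * ∫ v in C β, Ω β (linkEmbed L v) ∂orthoTransverse L := by
    filter_upwards [Filter.eventually_gt_atTop (0 : ℝ)] with β hβ0
    have h := hint β (fun v => (1 + β * ‖linkEmbed L v‖ ^ 2) ^ 4 * (Real.sqrt β * ‖linkEmbed L v‖) ^ (3 * Fintype.card {x : Site 3 L // ¬x = 0}))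
      (((measurable_const.add ((hle.norm.pow_const 2).const_mul β)).pow_const 4).mul ((measurable_const.mul hle.norm).pow_const _)) (fun v => by positivity) fun v hv => by
        obtain ⟨h1, h2⟩ := hsupp β v hv hβ0
        have ha : (1 + β * ‖linkEmbed L v‖ ^ 2) ^ 4 ≤ 16 := by
          calc (1 + β * ‖linkEmbed L v‖ ^ 2) ^ 4 ≤ (1 + 1) ^ 4 := pow_le_pow_left₀ (by positivity) (by linarith) 4
            _ = 16 := by norm_num
        have hb : (Real.sqrt β * ‖linkEmbed L v‖) ^ (3 * Fintype.card {x : Site 3 L // ¬x = 0}) ≤ 1 := pow_le_one₀ (by positivity) h1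
        calc (1 + β * ‖linkEmbed L v‖ ^ 2) ^ 4 * (Real.sqrt β * ‖linkEmbed L v‖) ^ (3 * Fintype.card {x : Site 3 L // ¬x = 0}) ≤ 16 * 1 :=
              mul_le_mul ha hb (by positivity) (by norm_num)
          _ = 16 := by norm_num
    refine le_trans (le_of_eq ?_) h
    refine integral_congr_ae (ae_of_all _ fun v => ?_)
    simp only [mul_assoc]
  have htail : ∀ β, 1 ≤ β → ∀ (g : (Edge 3 L → Fin 3 → ℝ) → ℝ),
      ∫ v in {v | β ^ ((1 : ℝ) / 8) < β * ‖linkEmbed L v‖ ^ 2}, Ω β (linkEmbed L v) * g v ∂orthoTransverse L = 0 := by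
    intro β hβ1 g
    refine setIntegral_eq_zero_of_forall_eq_zero fun v hv => ?_
    simp only [Set.mem_setOf_eq] at hv
    by_cases h : Ω β (linkEmbed L v) = 0
    · rw [h, zero_mul]
    · exfalso
      have h2 := (hsupp β v h (by linarith)).2
      have hT1 : 1 ≤ β ^ ((1 : ℝ) / 8) := Real.one_le_rpow hβ1 (by norm_num)
      linarith
  have htail0 : ∀ᶠ β : ℝ in atTop, ∫ v in {v | β ^ ((1 : ℝ) / 8) < β * ‖linkEmbed L v‖ ^ 2}, Ω β (linkEmbed L v) ∂orthoTransverse L ≤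
      (fun _ : ℝ => (0 : ℝ)) β * ∫ v in C β, Ω β (linkEmbed L v) ∂orthoTransverse L := by
    filter_upwards [Filter.eventually_ge_atTop (1 : ℝ)] with β hβ1
    have h := htail β hβ1 (fun _ => 1)
    simp only [mul_one] at h
    rw [h]; simp
  have htail3 : ∀ᶠ β : ℝ in atTop, ∫ v in {v | β ^ ((1 : ℝ) / 8) < β * ‖linkEmbed L v‖ ^ 2}, Ω β (linkEmbed L v) * (Real.sqrt β * ‖linkEmbed L v‖) ^ (3 * Fintype.card {x : Site 3 L // ¬x = 0}) ∂orthoTransverse L ≤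
      (fun _ : ℝ => (0 : ℝ)) β * ∫ v in C β, Ω β (linkEmbed L v) ∂orthoTransverse L := by
    filter_upwards [Filter.eventually_ge_atTop (1 : ℝ)] with β hβ1
    rw [htail β hβ1]; simp
  have hRτ : ∀ᶠ β : ℝ in atTop, (fun β : ℝ => (Real.sqrt β)⁻¹) β ≤ 1 / 30 := by
    filter_upwards [Filter.eventually_ge_atTop (900 : ℝ)] with β hβ; exact (inv_sqrt_window hβ).2.1
  exact exactDressing_of_profileNumbers (L := L) (A := 16) (At := 0) (ct := 1) hDw (by norm_num) le_rfl one_pos Ω CΩ (fun β => (Real.sqrt β)⁻¹) (fun β => (Real.sqrt β)⁻¹)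
    (fun _ => 0) C hΩm hCΩ hΩ0 hΩinv (fun β v hv => ⟨(hΩs β v hv).1, (hΩs β v hv).2.1⟩) hRτ (fun β v hv => (hΩs β v hv).2.2) (window_compatible_invSqrt (L := L) hDw) hC hCsub hθ' hI hM
    hI4 hM4 (Filter.Eventually.of_forall fun _ => le_rfl) htail0 htail3 (Filter.Eventually.of_forall fun β => by positivity)

end Summit.QuantumFields.YangMills.Theorems.FemtoTransferGap.RateTube

end
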